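import Summits.Ventures.HodgeRepro2.T5SU11ResolventSourceIntegrable

/-!
# Exponentially decaying sources are admissible for the improper Green's operator `G^I_λ`

Rows 492–494 built the improper Green's operator `G^I_λ` and verified its hypotheses for the particular source
`G_{λ₂} f`. Here the same is done for the whole EXPONENTIALLY DECAYING CLASS: a source `g` continuous on `(0, ∞)`,
bounded on `(0, 1]`, with `|g(s)| ≤ C e^{−εs}` for `s ≥ s₀`, where **`ε > 2 − λ`** (the rate at which `χ_λ sinh 2s ~
e^{(2−λ)s}` grows): then

* **`φ_λ g sinh 2s` is integrable on every `(0, T]`** (`integrableOn_sph_mul_mul_sinh_Ioc`: bounded on `(0, 1]`,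
  continuous on `[1, T]`), and
* **`χ_λ g sinh 2s` is integrable on `(0, ∞)`** (`integrableOn_sphDecay_mul_mul_sinh`: bounded on `(0, 1]` by row
  493's logarithmic bound on `T_λ`, continuous on `[1, T]`, dominated by `C' e^{(2−λ−ε)s}` on `(T, ∞)`),

so `G^I_λ g` is defined, solves `(L − μ)u = g` (row 492) and is bounded at the origin (row 493). The decay of `G^I_λ g`
relative to `φ_λ` and the resulting uniqueness statement follow in the next row. Nothing is claimed about (N).

Blind lane: Mathlib + the HodgeRepro2 prefix only; no sorry; axioms ⊆ {propext, Classical.choice,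
Quot.sound}.
-/

namespace Summit.Ventures.HodgeRepro2.T5SU11RadialGreenImproperDecaySource

open Filter Topology MeasureTheory intervalIntegral
open Set (Ioi Ioc Icc)
open T5SU11Cartan T5SU11SphericalFunction T5SU11SphericalBounds T5SU11SphericalContinuous
  T5SU11SphericalSolutionSpaceAll T5SU11ReductionOfOrder T5SU11ReductionOfOrderInfinity T5SU11SphericalDecay
  T5SU11SphericalDecayAsymptotic T5SU11SphericalDecayBracket T5SU11ResolventBoundary
  T5SU11RadialGreenImproperOrigin T5SU11ResolventSourceIntegrable

section measure

variable [MeasurableSpace Circle] [BorelSpace Circle]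

variable {lam : ℝ} (hlam : 1 < lam) {g : ℝ → ℝ} (hg : ContinuousOn g (Ioi 0))
  {M : ℝ} (hM : ∀ s ∈ Ioc (0 : ℝ) 1, |g s| ≤ M) (hM0 : 0 ≤ M)
  {ε C s₀ : ℝ} (hε : 2 - lam < ε) (hC : ∀ s, s₀ ≤ s → |g s| ≤ C * Real.exp (-ε * s))

include hg hM hM0 in
/-- **`φ_λ g sinh 2s` is integrable on every `(0, T]`** for a source continuous on `(0, ∞)` and bounded on `(0, 1]`. -/
theorem integrableOn_sph_mul_mul_sinh_Ioc (lam : ℝ) (T : ℝ) :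
    IntegrableOn (fun s => sph lam (hyp s) * g s * Real.sinh (2 * s)) (Ioc 0 T) := by
  obtain ⟨Φ, hΦ, hΦle⟩ := exists_sph_hyp_le lam
  have hcont : ContinuousOn (fun s => sph lam (hyp s) * g s * Real.sinh (2 * s)) (Ioi 0) :=
    ((continuous_sph_hyp lam).continuousOn.mul hg).mul
      (Real.continuous_sinh.comp (continuous_const.mul continuous_id)).continuousOn
  have hI1 : IntegrableOn (fun s => sph lam (hyp s) * g s * Real.sinh (2 * s)) (Ioc 0 1) := by
    refine (integrableOn_const (C := Φ * M * Real.sinh 2)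
      (by rw [Real.volume_Ioc]; exact ENNReal.ofReal_ne_top)).mono'
      ((hcont.mono (fun s hs => hs.1)).aestronglyMeasurable measurableSet_Ioc) ?_
    refine ae_restrict_of_forall_mem measurableSet_Ioc (fun s hs => ?_)
    have hs0 : 0 < s := hs.1
    rw [Real.norm_eq_abs, abs_mul, abs_mul, abs_of_pos (sph_hyp_pos lam s),
      abs_of_nonneg (Real.sinh_nonneg_iff.mpr (by linarith))]
    exact mul_le_mul (mul_le_mul (hΦle s ⟨hs0.le, hs.2⟩) (hM s hs) (abs_nonneg _) hΦ.le)
      (Real.sinh_le_sinh.mpr (by linarith [hs.2])) (Real.sinh_nonneg_iff.mpr (by linarith))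
      (mul_nonneg hΦ.le hM0)
  have hI2 : IntegrableOn (fun s => sph lam (hyp s) * g s * Real.sinh (2 * s)) (Ioc 1 T) :=
    ((hcont.mono (fun s hs => lt_of_lt_of_le one_pos hs.1)).integrableOn_Icc).mono_set Set.Ioc_subset_Icc_self
  rcases le_or_gt 1 T with h1T | h1T
  · have := hI1.union hI2
    rwa [Set.Ioc_union_Ioc_eq_Ioc zero_le_one h1T] at this
  · exact hI1.mono_set (Set.Ioc_subset_Ioc_right h1T.le)

include hlam hg hM hM0 in
/-- **`χ_λ g sinh 2s` is integrable on `(0, 1]`** for a source bounded on `(0, 1]` (row 493's logarithmic bound). -/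
theorem integrableOn_sphDecay_mul_mul_sinh_Ioc_one :
    IntegrableOn (fun s => sphDecay lam s * g s * Real.sinh (2 * s)) (Ioc 0 1) := by
  obtain ⟨m, hm, hmin⟩ := exists_sph_hyp_sq_ge lam
  obtain ⟨Φ, hΦ, hΦle⟩ := exists_sph_hyp_le lam
  set T1 := tailIntegral (fun t => sph lam (hyp t)) 1 with hT1
  have hT1pos : 0 < T1 :=
    tailIntegral_pos (hφ_sph lam) (hpos_sph lam) (integrableOn_roIntegrand_sph hlam) one_pos
  have hcont : ContinuousOn (fun s => sphDecay lam s * g s * Real.sinh (2 * s)) (Ioc 0 1) := by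
    have hχ : ContinuousOn (sphDecay lam) (Ioi 0) :=
      fun t ht => (hasDerivAt_sphDecay hlam ht).continuousAt.continuousWithinAt
    exact ((hχ.mul hg).mul (Real.continuous_sinh.comp (continuous_const.mul continuous_id)).continuousOn).mono
      (fun s hs => hs.1)
  set K := Φ * (T1 + 1 / (2 * m)) * M * (2 * Real.exp 2) with hK
  refine (integrableOn_const (C := K) (by rw [Real.volume_Ioc]; exact ENNReal.ofReal_ne_top)).mono'
    (hcont.aestronglyMeasurable measurableSet_Ioc) ?_
  refine ae_restrict_of_forall_mem measurableSet_Ioc (fun s hs => ?_)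
  have hs0 : 0 < s := hs.1
  have hT := tailIntegral_le_of_le_one hlam hm hmin hs0 hs.2
  have hTpos : 0 < tailIntegral (fun t => sph lam (hyp t)) s :=
    tailIntegral_pos (hφ_sph lam) (hpos_sph lam) (integrableOn_roIntegrand_sph hlam) hs0
  have hlog : 0 ≤ -Real.log s := neg_nonneg.mpr (Real.log_nonpos hs0.le hs.2)
  have hsinh : Real.sinh (2 * s) ≤ 2 * Real.exp 2 * s := by
    calc Real.sinh (2 * s) ≤ 2 * s * Real.exp (2 * s) := sinh_le_mul_exp (by linarith)
      _ ≤ 2 * s * Real.exp 2 :=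
          mul_le_mul_of_nonneg_left (Real.exp_le_exp.mpr (by linarith [hs.2])) (by linarith)
      _ = 2 * Real.exp 2 * s := by ring
  have hχ : sphDecay lam s ≤ Φ * (T1 + (-Real.log s) / (2 * m)) := by
    show sph lam (hyp s) * tailIntegral (fun t => sph lam (hyp t)) s ≤ _
    exact mul_le_mul (hΦle s ⟨hs0.le, hs.2⟩) hT hTpos.le hΦ.le
  have hχ0 : 0 ≤ sphDecay lam s := (sphDecay_pos hlam hs0).le
  have hs0' : 0 ≤ Real.sinh (2 * s) := Real.sinh_nonneg_iff.mpr (by linarith)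
  have hnn : 0 ≤ Φ * (T1 + (-Real.log s) / (2 * m)) :=
    mul_nonneg hΦ.le (add_nonneg hT1pos.le (div_nonneg hlog (by positivity)))
  rw [Real.norm_eq_abs, abs_mul, abs_mul, abs_of_nonneg hχ0, abs_of_nonneg hs0']
  calc sphDecay lam s * |g s| * Real.sinh (2 * s)
      ≤ (Φ * (T1 + (-Real.log s) / (2 * m))) * M * (2 * Real.exp 2 * s) :=
        mul_le_mul (mul_le_mul hχ (hM s hs) (abs_nonneg _) hnn) hsinh hs0' (mul_nonneg hnn hM0)
    _ = Φ * M * (2 * Real.exp 2) * (T1 * s + (-(s * Real.log s)) / (2 * m)) := by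
        field_simp
    _ ≤ Φ * M * (2 * Real.exp 2) * (T1 + 1 / (2 * m)) := by
        refine mul_le_mul_of_nonneg_left ?_ (by positivity)
        have h1 : T1 * s ≤ T1 := mul_le_of_le_one_right hT1pos.le hs.2
        have h2 : (-(s * Real.log s)) / (2 * m) ≤ 1 / (2 * m) :=
          div_le_div_of_nonneg_right (neg_mul_log_le_one hs0) (by positivity)
        linarith
    _ = K := by rw [hK]; ring

include hlam hg hM hM0 hε hC in
/-- **`χ_λ g sinh 2s` is integrable on `(0, ∞)`** for an exponentially decaying source with rate `ε > 2 − λ`. -/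
theorem integrableOn_sphDecay_mul_mul_sinh :
    IntegrableOn (fun s => sphDecay lam s * g s * Real.sinh (2 * s)) (Ioi 0) := by
  set L := 1 / ((lam - 1) * T5SU11SphericalAsymptotic.cfun (2 - lam)) with hL
  have hLpos : 0 < L := sphDecay_limit_pos hlam
  obtain ⟨T₀, hT₀⟩ := eventually_atTop.mp (eventually_sphDecay_le hlam)
  set T := max (max T₀ s₀) 1 with hT
  have h1T : 1 ≤ T := le_max_right _ _
  have hcont : ContinuousOn (fun s => sphDecay lam s * g s * Real.sinh (2 * s)) (Ioi 0) := by
    have hχ : ContinuousOn (sphDecay lam) (Ioi 0) :=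
      fun t ht => (hasDerivAt_sphDecay hlam ht).continuousAt.continuousWithinAt
    exact (hχ.mul hg).mul (Real.continuous_sinh.comp (continuous_const.mul continuous_id)).continuousOn
  have hI1 := integrableOn_sphDecay_mul_mul_sinh_Ioc_one hlam hg hM hM0
  have hI2 : IntegrableOn (fun s => sphDecay lam s * g s * Real.sinh (2 * s)) (Ioc 1 T) :=
    ((hcont.mono (fun s hs => lt_of_lt_of_le one_pos hs.1)).integrableOn_Icc).mono_set Set.Ioc_subset_Icc_self
  have hI3 : IntegrableOn (fun s => sphDecay lam s * g s * Real.sinh (2 * s)) (Ioi T) := by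
    set C' := 2 * L * |C| / 2 with hC'
    have hmaj : IntegrableOn (fun s => C' * Real.exp (-(lam + ε - 2) * s)) (Ioi T) :=
      (exp_neg_integrableOn_Ioi T (by linarith)).const_mul _
    refine hmaj.mono' ?_ ?_
    · exact (hcont.mono (Set.Ioi_subset_Ioi (by linarith))).aestronglyMeasurable measurableSet_Ioi
    · refine ae_restrict_of_forall_mem measurableSet_Ioi (fun s hs => ?_)
      have hs' : T < s := hs
      have hs0 : 0 < s := lt_of_lt_of_le (lt_of_lt_of_le one_pos h1T) hs'.le
      have hb1 := hT₀ s (le_trans (le_trans (le_max_left _ _) (le_max_left _ _)) hs'.le)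
      have hgs := hC s (le_trans (le_trans (le_max_right _ _) (le_max_left _ _)) hs'.le)
      have hsh : Real.sinh (2 * s) ≤ Real.exp (2 * s) / 2 := sinh_le_exp_div_two _
      have hsh0 : 0 ≤ Real.sinh (2 * s) := Real.sinh_nonneg_iff.mpr (by linarith)
      have hχ0 : 0 ≤ sphDecay lam s := (sphDecay_pos hlam hs0).le
      have hCexp : C * Real.exp (-ε * s) ≤ |C| * Real.exp (-ε * s) :=
        mul_le_mul_of_nonneg_right (le_abs_self C) (Real.exp_pos _).le
      rw [Real.norm_eq_abs, abs_mul, abs_mul, abs_of_nonneg hχ0, abs_of_nonneg hsh0]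
      calc sphDecay lam s * |g s| * Real.sinh (2 * s)
          ≤ (2 * L * Real.exp (-lam * s)) * (|C| * Real.exp (-ε * s)) * (Real.exp (2 * s) / 2) :=
            mul_le_mul (mul_le_mul hb1 (le_trans hgs hCexp) (abs_nonneg _) (by positivity)) hsh hsh0
              (by positivity)
        _ = C' * Real.exp (-(lam + ε - 2) * s) := by
            rw [hC', show Real.exp (-(lam + ε - 2) * s)
                = Real.exp (-lam * s) * Real.exp (-ε * s) * Real.exp (2 * s) by
              rw [← Real.exp_add, ← Real.exp_add]; congr 1; ring]
            ring
  have h12 := hI1.union hI2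
  rw [Set.Ioc_union_Ioc_eq_Ioc zero_le_one h1T] at h12
  have := h12.union hI3
  rwa [Set.Ioc_union_Ioi_eq_Ioi (le_trans zero_le_one h1T)] at this

end measure

end Summit.Ventures.HodgeRepro2.T5SU11RadialGreenImproperDecaySource
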